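import Literature.Barriers.ResolutionOfSingularities.LocalMonomializationFailsSetup
import Literature.AlgebraicGeometry.Resolution.OriginQuadraticTransform
import HarnessLib

/-!
# Cutkosky's counterexample: the infinite towers of quadratic transforms

`Literature/Barriers/ResolutionOfSingularities/LocalMonomializationFailsTowers.lean` — the
construction "By Lemma 3.1 we can inductively construct infinite sequences of quadratic
transforms `B = B₀ → B₁ → ⋯ → B_p → ⋯ → B_{2p} → ⋯`, `A = A₀ → ⋯ → A_p → ⋯`" of Cutkosky §3
(p. 6), GRANTED Lemma 3.1 as the named fact `CutkoskyLemma31`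
(`LocalMonomializationFailsLemma.lean`): a `Stage` records the data at the start of a block of
`p` transforms (coordinates `b = (x_{pi}, y_{pi})` of `B_{pi}` generating `L`, `a = (u_{pi}, v_{pi})`
of `A_{pi}` generating `K`, the inclusion with domination `A_{pi} ⊆ B_{pi}` and the expansions (4)
in `B̂_{pi}`); `Stage.step` applies the lemma with an admissible `α` (which exists as `F` has
three elements) and moves to `B_{p(i+1)}`, `A_{p(i+1)}`; `stage i` iterates. PROVED here: the
recursion is well defined (algebraic independence of the new coordinates by a transcendence
degree count), the block-wise consequences (C1), (C4) of the lemma for every block, and the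
explicit towers `Bring l = F[x_l, y_l]_{(x_l,y_l)}`, `Aring m` with their quadratic-transform
steps and dominations. [cite: Cutkosky2014, §3 (pp. 5–7)]
-/

noncomputable section

namespace Literature.Barriers.ResolutionOfSingularities

namespace Cutkosky

open Literature.AlgebraicGeometry.Resolution
open scoped IntermediateField

universe u

variable {F : Type u} [Field F] {L : Type u} [Field L] [Algebra F L]

/-! ## Coordinate bookkeeping -/

section Coordinates

/-- Pointwise-equal coordinate families have the same local ring. [folklore] -/
theorem originLocalRing_congr {n : ℕ} {x y : Fin n → L} (hx : AlgebraicIndependent F x)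
    (hy : AlgebraicIndependent F y) (h : x = y) : originLocalRing hx = originLocalRing hy := by
  subst h; rfl

/-- Swapping the two coordinates does not change the local ring. [folklore] -/
theorem originLocalRing_swap {P Q : L} (h : AlgebraicIndependent F ![P, Q])
    (h' : AlgebraicIndependent F ![Q, P]) : originLocalRing h = originLocalRing h' := by
  have hPQ : ∀ i, ![P, Q] i ∈ originLocalRing h' := Fin.forall_fin_two.mpr
    ⟨by simpa using mem_originLocalRing_self h' 1, by simpa using mem_originLocalRing_self h' 0⟩
  have hQP : ∀ i, ![Q, P] i ∈ originLocalRing h := Fin.forall_fin_two.mpr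
    ⟨by simpa using mem_originLocalRing_self h 1, by simpa using mem_originLocalRing_self h 0⟩
  refine originLocalRing_eq_of_forall_mem h h' hPQ (Fin.forall_fin_two.mpr ⟨?_, ?_⟩) hQP
    (Fin.forall_fin_two.mpr ⟨?_, ?_⟩)
  · exact originCoord_mem_maximalIdeal h' 1
  · exact originCoord_mem_maximalIdeal h' 0
  · exact originCoord_mem_maximalIdeal h 1
  · exact originCoord_mem_maximalIdeal h 0

/-- The field generated by the coordinates of a quadratic transform is the field generated by the
original coordinates (`Q ≠ 0`). [cite: Cutkosky2014, §3] -/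
theorem adjoin_range_bCoord (p : ℕ) (P Q : L) (hQ : Q ≠ 0) (γ : F) (i : ℕ) :
    IntermediateField.adjoin F (Set.range (bCoord F L p P Q γ i)) = IntermediateField.adjoin F {P, Q} := by
  have hPm : P ∈ IntermediateField.adjoin F ({P, Q} : Set L) := IntermediateField.subset_adjoin _ _ (Set.mem_insert _ _)
  have hQm : Q ∈ IntermediateField.adjoin F ({P, Q} : Set L) := IntermediateField.subset_adjoin _ _ (Set.mem_insert_of_mem _ rfl)
  apply le_antisymm
  · rw [IntermediateField.adjoin_le_iff]
    rintro _ ⟨j, rfl⟩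
    unfold bCoord
    split_ifs with hi
    · fin_cases j
      · exact div_mem hPm (pow_mem hQm _)
      · exact hQm
    · fin_cases j
      · exact hQm
      · exact sub_mem (div_mem hPm (pow_mem hQm _)) (IntermediateField.algebraMap_mem _ _)
  · rw [IntermediateField.adjoin_le_iff]
    have h0 : bCoord F L p P Q γ i 0 ∈ IntermediateField.adjoin F (Set.range (bCoord F L p P Q γ i)) :=
      IntermediateField.subset_adjoin _ _ ⟨0, rfl⟩
    have h1 : bCoord F L p P Q γ i 1 ∈ IntermediateField.adjoin F (Set.range (bCoord F L p P Q γ i)) :=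
      IntermediateField.subset_adjoin _ _ ⟨1, rfl⟩
    unfold bCoord at h0 h1 ⊢
    split_ifs at h0 h1 ⊢ with hi
    · -- coordinates `(P/Qⁱ, Q)`
      simp only [Matrix.cons_val_zero, Matrix.cons_val_one] at h0 h1
      intro z hz
      rcases hz with h | h
      · rw [h]
        have hm := mul_mem h0 (pow_mem h1 i)
        rwa [div_mul_cancel₀ _ (pow_ne_zero i hQ)] at hm
      · rw [Set.mem_singleton_iff.mp h]; exact h1
    · -- coordinates `(Q, P/Qᵖ − γ)`
      simp only [Matrix.cons_val_zero, Matrix.cons_val_one] at h0 h1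
      intro z hz
      rcases hz with h | h
      · rw [h]
        have hm := mul_mem (add_mem h1 (IntermediateField.algebraMap_mem _ γ)) (pow_mem h0 p)
        rwa [sub_add_cancel, div_mul_cancel₀ _ (pow_ne_zero p hQ)] at hm
      · rw [Set.mem_singleton_iff.mp h]; exact h0

/-- The coordinates of the quadratic transforms of `B = F[x,y]_{(x,y)}`, `F(x,y) = L`, are
algebraically independent. [cite: Cutkosky2014, §3] -/
theorem algebraicIndependent_bCoord_of_top (p : ℕ) {P Q : L} (h : AlgebraicIndependent F ![P, Q])
    (hgen : IntermediateField.adjoin F {P, Q} = ⊤) (γ : F) (i : ℕ) :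
    AlgebraicIndependent F (bCoord F L p P Q γ i) :=
  algebraicIndependent_of_adjoin_eq_top h
    (by rw [adjoin_range_bCoord p P Q (by simpa using h.ne_zero 1) γ i, hgen])

/-- The coordinates of the quadratic transforms of `A = F[u,v]_{(u,v)}`, `L` algebraic over
`F(u,v)`, are algebraically independent. [cite: Cutkosky2014, §3] -/
theorem algebraicIndependent_bCoord_of_isAlgebraic (p : ℕ) {P Q : L} (h : AlgebraicIndependent F ![P, Q])
    (K : IntermediateField F L) [Algebra.IsAlgebraic K L]
    (hgen : IntermediateField.adjoin F {P, Q} = K) (γ : F) (i : ℕ) :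
    AlgebraicIndependent F (bCoord F L p P Q γ i) := by
  haveI : Algebra.IsAlgebraic (IntermediateField.adjoin F (Set.range (bCoord F L p P Q γ i))) L := by
    rw [adjoin_range_bCoord p P Q (by simpa using h.ne_zero 1) γ i, hgen]
    infer_instance
  exact algebraicIndependent_of_isAlgebraic_adjoin h

omit [Field L] [Algebra F L] in
/-- A pair as a family: `(a 0, a 1) = a`. [folklore] -/
theorem pair_eta (a : Fin 2 → L) : ![a 0, a 1] = a := by
  funext i; fin_cases i <;> rfl

end Coordinates

/-! ## Admissible `α` -/

omit [Field F] in
/-- In a field with at least three elements, some element avoids two prescribed values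
(`α ≠ 0`, `α ≠ −τ̄₀/e₀`). [cite: Cutkosky2014, Lemma 3.1] -/
theorem exists_ne_ne (h3 : ∃ a b c : F, a ≠ b ∧ b ≠ c ∧ a ≠ c) (s t : F) :
    ∃ α : F, α ≠ s ∧ α ≠ t := by
  obtain ⟨a, b, c, hab, hbc, hac⟩ := h3
  by_cases has : a = s
  · by_cases hbt : b = t
    · exact ⟨c, fun hcs => hac (has.trans hcs.symm), fun hct => hbc (hbt.trans hct.symm)⟩
    · exact ⟨b, fun hbs => hab (has.trans hbs.symm), hbt⟩
  · by_cases hat : a = t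
    · by_cases hbs : b = s
      · exact ⟨c, fun hcs => hbc (hbs.trans hcs.symm), fun hct => hac (hat.trans hct.symm)⟩
      · exact ⟨b, hbs, fun hbt => hab (hat.trans hbt.symm)⟩
    · exact ⟨a, has, hat⟩

/-! ## Stages -/

/-- **The data at the start of a block of `p` quadratic transforms** (Cutkosky §3, the rings
`A_{pi} ⊆ B_{pi}` with the expansions (13) = (4)): coordinates `b` of `B_{pi} = F[b]_{(b)}`
generating `L`, coordinates `a` of `A_{pi}` generating `K`, the inclusion with domination, and
the shape constants. [cite: Cutkosky2014, §3 (13)] -/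
structure Stage (F : Type u) [Field F] (L : Type u) [Field L] [Algebra F L] (p : ℕ)
    (K : IntermediateField F L) where
  /-- coordinates `(x_{pi}, y_{pi})` of `B_{pi}` -/
  b : Fin 2 → L
  /-- coordinates `(u_{pi}, v_{pi})` of `A_{pi}` -/
  a : Fin 2 → L
  hb : AlgebraicIndependent F b
  ha : AlgebraicIndependent F a
  hgenB : IntermediateField.adjoin F (Set.range b) = ⊤
  hgenA : IntermediateField.adjoin F (Set.range a) = K
  hle : originLocalRing ha ≤ originLocalRing hb
  hdom : Dominates F L (originLocalRing ha) (originLocalRing hb)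
  /-- the constants `c_i, f_i, e_i` of (13) -/
  c : F
  f : F
  e : F
  /-- the unit series `τ_i(y_{pi})` of (13) -/
  τ : MvPowerSeries (Fin 2) F
  shape : LemmaShape p hb ⟨a 0, hle (mem_originLocalRing_self ha 0)⟩
    ⟨a 1, hle (mem_originLocalRing_self ha 1)⟩ c f e τ

namespace Stage

variable {p : ℕ} {K : IntermediateField F L}
variable (h3 : ∃ a b c : F, a ≠ b ∧ b ≠ c ∧ a ≠ c)

/-- An admissible `α` for the block (`α ≠ 0`, `α ≠ −τ̄/e`), chosen once and for all.
[cite: Cutkosky2014, Lemma 3.1] -/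
def alpha (S : Stage F L p K) : F :=
  Classical.choose (exists_ne_ne h3 0 (-(MvPowerSeries.constantCoeff S.τ) / S.e))

/-- The chosen `α` is nonzero. [cite: Cutkosky2014, Lemma 3.1] -/
theorem alpha_ne_zero (S : Stage F L p K) : S.alpha h3 ≠ 0 :=
  (Classical.choose_spec (exists_ne_ne h3 0 (-(MvPowerSeries.constantCoeff S.τ) / S.e))).1

/-- The chosen `α` avoids `−τ̄/e`. [cite: Cutkosky2014, Lemma 3.1] -/
theorem alpha_ne (S : Stage F L p K) : S.alpha h3 ≠ -(MvPowerSeries.constantCoeff S.τ) / S.e :=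
  (Classical.choose_spec (exists_ne_ne h3 0 (-(MvPowerSeries.constantCoeff S.τ) / S.e))).2

/-- The constant `β` of the block. [cite: Cutkosky2014, Lemma 3.1] -/
def beta (S : Stage F L p K) : F :=
  betaConst p S.c S.e (MvPowerSeries.constantCoeff S.τ) (S.alpha h3)

/-- The `B`-coordinates inside the block and at its end: `bCoord` on the stage's coordinates.
[cite: Cutkosky2014, §3] -/
def bFam (S : Stage F L p K) (j : ℕ) : Fin 2 → L := bCoord F L p (S.b 0) (S.b 1) (S.alpha h3) j

/-- The `A`-coordinates inside the block and at its end. [cite: Cutkosky2014, §3] -/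
def aFam (S : Stage F L p K) (j : ℕ) : Fin 2 → L := bCoord F L p (S.a 0) (S.a 1) (S.beta h3) j

/-- The range of the `B`-coordinates. [folklore] -/
theorem range_b (S : Stage F L p K) : Set.range S.b = {S.b 0, S.b 1} := by
  have h := range_pair (S.b 0) (S.b 1); rwa [pair_eta] at h

/-- The range of the `A`-coordinates. [folklore] -/
theorem range_a (S : Stage F L p K) : Set.range S.a = {S.a 0, S.a 1} := by
  have h := range_pair (S.a 0) (S.a 1); rwa [pair_eta] at h

/-- The `B`-coordinates as a pair are algebraically independent. [folklore] -/
theorem hb_pair (S : Stage F L p K) : AlgebraicIndependent F ![S.b 0, S.b 1] := by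
  rw [pair_eta]; exact S.hb

/-- The `A`-coordinates as a pair are algebraically independent. [folklore] -/
theorem ha_pair (S : Stage F L p K) : AlgebraicIndependent F ![S.a 0, S.a 1] := by
  rw [pair_eta]; exact S.ha

/-- The `B`-coordinates of the block are algebraically independent. [cite: Cutkosky2014, §3] -/
theorem algebraicIndependent_bFam (S : Stage F L p K) (j : ℕ) : AlgebraicIndependent F (S.bFam h3 j) :=
  algebraicIndependent_bCoord_of_top p S.hb_pair (by rw [← S.range_b]; exact S.hgenB) _ j

/-- The `A`-coordinates of the block are algebraically independent (`L` algebraic over `K`).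
[cite: Cutkosky2014, §3] -/
theorem algebraicIndependent_aFam [Algebra.IsAlgebraic K L] (S : Stage F L p K) (j : ℕ) :
    AlgebraicIndependent F (S.aFam h3 j) :=
  algebraicIndependent_bCoord_of_isAlgebraic p S.ha_pair K (by rw [← S.range_a]; exact S.hgenA) _ j

variable [Fact p.Prime] [CharP F p]

/-- (C2)–(C3) of Lemma 3.1 for the stage: the inclusion with domination `A_{p(i+1)} ⊆ B_{p(i+1)}`
and the expansions (5). [cite: Cutkosky2014, Lemma 3.1] -/
theorem lemma31_C23 (hL : CutkoskyLemma31.{u}) [Algebra.IsAlgebraic K L] (S : Stage F L p K) :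
    ∃ hle : originLocalRing (S.algebraicIndependent_aFam h3 p) ≤ originLocalRing (S.algebraicIndependent_bFam h3 p),
      Dominates F L (originLocalRing (S.algebraicIndependent_aFam h3 p))
        (originLocalRing (S.algebraicIndependent_bFam h3 p)) ∧
      ∃ (c₁ f₁ e₁ : F) (τ₁ : MvPowerSeries (Fin 2) F),
        LemmaShape p (S.algebraicIndependent_bFam h3 p)
          ⟨_, hle (mem_originLocalRing_self (S.algebraicIndependent_aFam h3 p) 0)⟩
          ⟨_, hle (mem_originLocalRing_self (S.algebraicIndependent_aFam h3 p) 1)⟩ c₁ f₁ e₁ τ₁ :=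
  (hL F p h3 L S.a S.b S.ha S.hb S.hle S.hdom S.c S.f S.e S.τ S.shape (S.alpha h3) (S.alpha_ne_zero h3)
    (S.alpha_ne h3)).2.1 (S.algebraicIndependent_bFam h3 p) (S.algebraicIndependent_aFam h3 p)

/-- **The next stage** `(A_{p(i+1)} ⊆ B_{p(i+1)})`, read off (C2)–(C3) of Lemma 3.1.
[cite: Cutkosky2014, §3 (12)–(13)] -/
def step (hL : CutkoskyLemma31.{u}) [Algebra.IsAlgebraic K L] (S : Stage F L p K) : Stage F L p K where
  b := S.bFam h3 p
  a := S.aFam h3 p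
  hb := S.algebraicIndependent_bFam h3 p
  ha := S.algebraicIndependent_aFam h3 p
  hgenB := by
    change IntermediateField.adjoin F (Set.range (bCoord F L p (S.b 0) (S.b 1) (S.alpha h3) p)) = ⊤
    rw [adjoin_range_bCoord p _ _ (by simpa using S.hb_pair.ne_zero 1), ← S.range_b]; exact S.hgenB
  hgenA := by
    change IntermediateField.adjoin F (Set.range (bCoord F L p (S.a 0) (S.a 1) (S.beta h3) p)) = K
    rw [adjoin_range_bCoord p _ _ (by simpa using S.ha_pair.ne_zero 1), ← S.range_a]; exact S.hgenA
  hle := (S.lemma31_C23 h3 hL).fst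
  hdom := (S.lemma31_C23 h3 hL).snd.1
  c := (S.lemma31_C23 h3 hL).snd.2.choose
  f := (S.lemma31_C23 h3 hL).snd.2.choose_spec.choose
  e := (S.lemma31_C23 h3 hL).snd.2.choose_spec.choose_spec.choose
  τ := (S.lemma31_C23 h3 hL).snd.2.choose_spec.choose_spec.choose_spec.choose
  shape := (S.lemma31_C23 h3 hL).snd.2.choose_spec.choose_spec.choose_spec.choose_spec

end Stage

/-! ## The initial stage and the iteration -/

section Iterate

variable (p : ℕ) [Fact p.Prime] [CharP F p] {x y : L} (hxy : AlgebraicIndependent F ![x, y])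
  (hgen : IntermediateField.adjoin F {x, y} = ⊤)
  (h3 : ∃ a b c : F, a ≠ b ∧ b ≠ c ∧ a ≠ c) (hL : CutkoskyLemma31.{u})

/-- **The initial stage** `A = F[u,v]_{(u,v)} ⊆ B = F[x,y]_{(x,y)}` with the expansions
`u = xᵖ(1+y)`, `v = yᵖ + x`. [cite: Cutkosky2014, §3] -/
def stage0 : Stage F L p (Kuv F p x y) where
  b := ![x, y]
  a := ![cu p x y, cv p x y]
  hb := hxy
  ha := algebraicIndependent_uv F p hgen hxy
  hgenB := by rw [range_pair]; exact hgen
  hgenA := by rw [range_pair]; rfl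
  hle := A_le_B p hxy (algebraicIndependent_uv F p hgen hxy)
  hdom := dominates_A_B p hxy (algebraicIndependent_uv F p hgen hxy)
  c := 1
  f := 1
  e := 1
  τ := 1
  shape := lemmaShape_initial p hxy _ _

/-- **The stages** `(A_{pi} ⊆ B_{pi})_{i ≥ 0}`. [cite: Cutkosky2014, §3 (12)] -/
def stage : ℕ → Stage F L p (Kuv F p x y)
  | 0 => stage0 p hxy hgen
  | i + 1 =>
    haveI := isAlgebraic_Kuv F p hgen
    (stage i).step h3 hL

/-- Unfolding the recursion at `0`. [folklore] -/
theorem stage_zero : stage p hxy hgen h3 hL 0 = stage0 p hxy hgen := rfl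

/-- Unfolding the recursion at a successor. [folklore] -/
theorem stage_succ (i : ℕ) :
    stage p hxy hgen h3 hL (i + 1) = (haveI := isAlgebraic_Kuv F p hgen; (stage p hxy hgen h3 hL i).step h3 hL) := rfl

end Iterate

/-! ## One quadratic transform inside a block: `bCoord j → bCoord (j+1)` -/

section OneStep

variable (p : ℕ) {P Q : L} (γ : F)

/-- Coordinates `j → j+1` inside a block (`j + 1 < p`): `(P/Qʲ, Q) ↦ ((P/Qʲ)/Q, Q)`.
[cite: Cutkosky2014, Lemma 3.1] -/
theorem bCoord_succ_of_lt {j : ℕ} (hj : j + 1 < p) :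
    bCoord F L p P Q γ (j + 1) =
      ![bCoord F L p P Q γ j 0 / bCoord F L p P Q γ j 1, bCoord F L p P Q γ j 1] := by
  have hj' : j < p := Nat.lt_of_succ_lt hj
  simp only [bCoord, hj, hj', if_true, Matrix.cons_val_zero, Matrix.cons_val_one]
  rw [pow_succ, div_div]

/-- Coordinates `p − 1 → p` (the last transform of a block): `(P/Qᵖ⁻¹, Q) ↦ (Q, (P/Qᵖ⁻¹)/Q − γ)`.
[cite: Cutkosky2014, Lemma 3.1] -/
theorem bCoord_succ_of_eq {j : ℕ} (hj : j + 1 = p) :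
    bCoord F L p P Q γ (j + 1) =
      ![bCoord F L p P Q γ j 1, bCoord F L p P Q γ j 0 / bCoord F L p P Q γ j 1 - algebraMap F L γ] := by
  have hj' : j < p := by omega
  have hp : ¬ (j + 1 < p) := by omega
  simp only [bCoord, hp, hj', if_true, if_false, Matrix.cons_val_zero, Matrix.cons_val_one]
  rw [← hj, pow_succ, div_div]

/-- Swapping a pair preserves algebraic independence. [folklore] -/
theorem algebraicIndependent_pair_swap {a b : L} (h : AlgebraicIndependent F ![a, b]) :
    AlgebraicIndependent F ![b, a] := by
  have := h.comp Fin.rev Fin.rev_injective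
  rwa [show (![a, b] ∘ Fin.rev) = ![b, a] from by funext i; fin_cases i <;> rfl] at this

/-- **Each step inside a block is a quadratic transform with domination**: for `j < p`,
`F[bCoord (j+1)]_{(…)}` is a quadratic transform of `F[bCoord j]_{(…)}` (Cutkosky §2.1) and
dominates it. [cite: Cutkosky2014, Lemma 3.1 and §2.1] -/
theorem isQuadraticTransform_bCoord_succ {j : ℕ} (hj : j < p)
    (h₁ : AlgebraicIndependent F (bCoord F L p P Q γ j))
    (h₂ : AlgebraicIndependent F (bCoord F L p P Q γ (j + 1))) :
    IsQuadraticTransform (originLocalRing h₁).toSubring (originLocalRing h₂).toSubring ∧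
      SubringDominates (originLocalRing h₁).toSubring (originLocalRing h₂).toSubring := by
  -- the source as a pair `(P', Q')`
  have h₁' : AlgebraicIndependent F ![bCoord F L p P Q γ j 0, bCoord F L p P Q γ j 1] := by
    rw [pair_eta]; exact h₁
  have e₁ : originLocalRing h₁ = originLocalRing h₁' := originLocalRing_congr h₁ h₁' (pair_eta _).symm
  rcases Nat.lt_or_ge (j + 1) p with hlt | hge
  · -- inside the block: the blown-up point `γ = 0`, coordinates swapped
    have hb := bCoord_succ_of_lt p (P := P) (Q := Q) γ hlt
    have h₂' : AlgebraicIndependent F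
        ![bCoord F L p P Q γ j 0 / bCoord F L p P Q γ j 1, bCoord F L p P Q γ j 1] := by
      rw [← hb]; exact h₂
    have h₃' := algebraicIndependent_pair_swap h₂'
    have hfam : ![bCoord F L p P Q γ j 1,
        bCoord F L p P Q γ j 0 / bCoord F L p P Q γ j 1 - algebraMap F L 0] =
        ![bCoord F L p P Q γ j 1, bCoord F L p P Q γ j 0 / bCoord F L p P Q γ j 1] := by
      rw [map_zero, sub_zero]
    have h₃ : AlgebraicIndependent F ![bCoord F L p P Q γ j 1,
        bCoord F L p P Q γ j 0 / bCoord F L p P Q γ j 1 - algebraMap F L 0] := by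
      rw [hfam]; exact h₃'
    have eR : originLocalRing h₂ = originLocalRing h₃ := by
      rw [originLocalRing_congr h₂ h₂' hb, originLocalRing_swap h₂' h₃',
        originLocalRing_congr h₃' h₃ hfam.symm]
    rw [e₁, eR]
    exact ⟨isQuadraticTransform_blowupPoint h₁' 0 h₃, subringDominates_blowupPoint h₁' 0 h₃⟩
  · -- the last transform of the block: the blown-up point `γ`
    have hjp : j + 1 = p := le_antisymm hj hge
    have hb := bCoord_succ_of_eq p (P := P) (Q := Q) γ hjp
    have h₃ : AlgebraicIndependent F ![bCoord F L p P Q γ j 1,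
        bCoord F L p P Q γ j 0 / bCoord F L p P Q γ j 1 - algebraMap F L γ] := by
      rw [← hb]; exact h₂
    rw [e₁, originLocalRing_congr h₂ h₃ hb]
    exact ⟨isQuadraticTransform_blowupPoint h₁' γ h₃, subringDominates_blowupPoint h₁' γ h₃⟩

end OneStep

/-! ## The explicit towers `B_l`, `A_m` -/

namespace Stage

variable {p : ℕ} {K : IntermediateField F L} (h3 : ∃ a b c : F, a ≠ b ∧ b ≠ c ∧ a ≠ c) [hp : Fact p.Prime]

/-- `B_{pi} = B_{pi+0}`: the `0`-th coordinates of a block are the stage's coordinates.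
[cite: Cutkosky2014, §3] -/
theorem bFam_zero (S : Stage F L p K) : S.bFam h3 0 = S.b := by
  funext i
  fin_cases i <;> simp [bFam, bCoord, hp.out.pos]

/-- `A_{pi} = A_{pi+0}`. [cite: Cutkosky2014, §3] -/
theorem aFam_zero (S : Stage F L p K) : S.aFam h3 0 = S.a := by
  funext i
  fin_cases i <;> simp [aFam, bCoord, hp.out.pos]

variable [CharP F p] (hL : CutkoskyLemma31.{u}) [Algebra.IsAlgebraic K L]

/-- The next stage's `B`-coordinates are the `p`-th coordinates of the block. [cite: Cutkosky2014, §3] -/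
theorem step_b (S : Stage F L p K) : (S.step h3 hL).b = S.bFam h3 p := rfl

/-- The next stage's `A`-coordinates are the `p`-th coordinates of the block. [cite: Cutkosky2014, §3] -/
theorem step_a (S : Stage F L p K) : (S.step h3 hL).a = S.aFam h3 p := rfl

end Stage

section Towers

variable (p : ℕ) [hp : Fact p.Prime] [CharP F p] {x y : L} (hxy : AlgebraicIndependent F ![x, y])
  (hgen : IntermediateField.adjoin F {x, y} = ⊤)
  (h3 : ∃ a b c : F, a ≠ b ∧ b ≠ c ∧ a ≠ c) (hL : CutkoskyLemma31.{u})

/-- The coordinates `(x_l, y_l)` of `B_l`, `l = pi + j`, `0 ≤ j < p`. [cite: Cutkosky2014, §3 (12)] -/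
def Bfam (l : ℕ) : Fin 2 → L := (stage p hxy hgen h3 hL (l / p)).bFam h3 (l % p)

/-- The coordinates of `B_l` are algebraically independent. [cite: Cutkosky2014, §3] -/
theorem algebraicIndependent_Bfam (l : ℕ) : AlgebraicIndependent F (Bfam p hxy hgen h3 hL l) :=
  (stage p hxy hgen h3 hL (l / p)).algebraicIndependent_bFam h3 (l % p)

/-- **`B_l = F[x_l, y_l]_{(x_l, y_l)}`**, the `l`-th member of the tower of quadratic transforms of
`B`. [cite: Cutkosky2014, §3 (12)] -/
def Bring (l : ℕ) : Subalgebra F L := originLocalRing (algebraicIndependent_Bfam p hxy hgen h3 hL l)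

/-- The coordinates `(u_m, v_m)` of `A_m`. [cite: Cutkosky2014, §3 (12)] -/
def Afam (m : ℕ) : Fin 2 → L := (stage p hxy hgen h3 hL (m / p)).aFam h3 (m % p)

/-- The coordinates of `A_m` are algebraically independent. [cite: Cutkosky2014, §3] -/
theorem algebraicIndependent_Afam (m : ℕ) : AlgebraicIndependent F (Afam p hxy hgen h3 hL m) := by
  haveI := isAlgebraic_Kuv F p hgen
  exact (stage p hxy hgen h3 hL (m / p)).algebraicIndependent_aFam h3 (m % p)

/-- **`A_m = F[u_m, v_m]_{(u_m, v_m)}`**, the `m`-th member of the tower of quadratic transforms of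
`A`. [cite: Cutkosky2014, §3 (12)] -/
def Aring (m : ℕ) : Subalgebra F L := originLocalRing (algebraicIndependent_Afam p hxy hgen h3 hL m)

/-- Index bookkeeping: `l = pi + j`, `j < p`. [folklore] -/
theorem Bfam_eq (i j : ℕ) (hj : j < p) :
    Bfam p hxy hgen h3 hL (p * i + j) = (stage p hxy hgen h3 hL i).bFam h3 j := by
  have h1 : (p * i + j) / p = i := by
    rw [Nat.mul_add_div hp.out.pos, Nat.div_eq_of_lt hj, add_zero]
  have h2 : (p * i + j) % p = j := by
    rw [Nat.mul_add_mod, Nat.mod_eq_of_lt hj]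
  rw [Bfam, h1, h2]

/-- Index bookkeeping for the `A`-tower. [folklore] -/
theorem Afam_eq (i j : ℕ) (hj : j < p) :
    Afam p hxy hgen h3 hL (p * i + j) = (stage p hxy hgen h3 hL i).aFam h3 j := by
  have h1 : (p * i + j) / p = i := by
    rw [Nat.mul_add_div hp.out.pos, Nat.div_eq_of_lt hj, add_zero]
  have h2 : (p * i + j) % p = j := by
    rw [Nat.mul_add_mod, Nat.mod_eq_of_lt hj]
  rw [Afam, h1, h2]

/-- The last member of a block is the first of the next: `B_{pi + p} = B_{p(i+1)}` has the `p`-th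
coordinates of block `i`. [cite: Cutkosky2014, §3 (12)] -/
theorem Bfam_eq_top (i : ℕ) :
    Bfam p hxy hgen h3 hL (p * i + p) = (stage p hxy hgen h3 hL i).bFam h3 p := by
  haveI := isAlgebraic_Kuv F p hgen
  rw [show p * i + p = p * (i + 1) + 0 by ring, Bfam_eq p hxy hgen h3 hL (i + 1) 0 hp.out.pos,
    Stage.bFam_zero, stage_succ, Stage.step_b]

/-- `A_{pi + p} = A_{p(i+1)}`. [cite: Cutkosky2014, §3 (12)] -/
theorem Afam_eq_top (i : ℕ) :
    Afam p hxy hgen h3 hL (p * i + p) = (stage p hxy hgen h3 hL i).aFam h3 p := by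
  haveI := isAlgebraic_Kuv F p hgen
  rw [show p * i + p = p * (i + 1) + 0 by ring, Afam_eq p hxy hgen h3 hL (i + 1) 0 hp.out.pos,
    Stage.aFam_zero, stage_succ, Stage.step_a]

/-- For every `j ≤ p`, `B_{pi+j}` is the local ring on the block coordinates `bFam j`.
[cite: Cutkosky2014, §3 (12)] -/
theorem Bring_eq (i j : ℕ) (hj : j ≤ p)
    (h : AlgebraicIndependent F ((stage p hxy hgen h3 hL i).bFam h3 j)) :
    Bring p hxy hgen h3 hL (p * i + j) = originLocalRing h := by
  apply originLocalRing_congr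
  rcases hj.lt_or_eq with hj | hj
  · exact Bfam_eq p hxy hgen h3 hL i j hj
  · rw [hj]; exact Bfam_eq_top p hxy hgen h3 hL i

/-- For every `j ≤ p`, `A_{pi+j}` is the local ring on the block coordinates `aFam j`.
[cite: Cutkosky2014, §3 (12)] -/
theorem Aring_eq (i j : ℕ) (hj : j ≤ p)
    (h : AlgebraicIndependent F ((stage p hxy hgen h3 hL i).aFam h3 j)) :
    Aring p hxy hgen h3 hL (p * i + j) = originLocalRing h := by
  apply originLocalRing_congr
  rcases hj.lt_or_eq with hj | hj
  · exact Afam_eq p hxy hgen h3 hL i j hj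
  · rw [hj]; exact Afam_eq_top p hxy hgen h3 hL i

/-- `B_{pi}` is the stage's `B`. [cite: Cutkosky2014, §3 (12)] -/
theorem Bring_stage (i : ℕ) : Bring p hxy hgen h3 hL (p * i) = originLocalRing (stage p hxy hgen h3 hL i).hb := by
  have h := (stage p hxy hgen h3 hL i).algebraicIndependent_bFam h3 0
  have e := Bring_eq p hxy hgen h3 hL i 0 (Nat.zero_le _) h
  rw [Nat.add_zero] at e
  exact e.trans (originLocalRing_congr h _ (Stage.bFam_zero h3 _))

/-- `A_{pi}` is the stage's `A`. [cite: Cutkosky2014, §3 (12)] -/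
theorem Aring_stage (i : ℕ) : Aring p hxy hgen h3 hL (p * i) = originLocalRing (stage p hxy hgen h3 hL i).ha := by
  haveI := isAlgebraic_Kuv F p hgen
  have h := (stage p hxy hgen h3 hL i).algebraicIndependent_aFam h3 0
  have e := Aring_eq p hxy hgen h3 hL i 0 (Nat.zero_le _) h
  rw [Nat.add_zero] at e
  exact e.trans (originLocalRing_congr h _ (Stage.aFam_zero h3 _))

/-- **`B₀ = B = F[x,y]_{(x,y)}`.** [cite: Cutkosky2014, §3] -/
theorem Bring_zero : Bring p hxy hgen h3 hL 0 = originLocalRing hxy := by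
  have := Bring_stage p hxy hgen h3 hL 0
  rw [Nat.mul_zero] at this
  exact this

/-- **`A₀ = A = F[u,v]_{(u,v)}`.** [cite: Cutkosky2014, §3] -/
theorem Aring_zero : Aring p hxy hgen h3 hL 0 = originLocalRing (algebraicIndependent_uv F p hgen hxy) := by
  have := Aring_stage p hxy hgen h3 hL 0
  rw [Nat.mul_zero] at this
  exact this

/-- **Every step of the `B`-tower is a quadratic transform with domination.**
[cite: Cutkosky2014, §3 (12) and Lemma 3.1] -/
theorem Bring_succ (l : ℕ) :
    IsQuadraticTransform (Bring p hxy hgen h3 hL l).toSubring (Bring p hxy hgen h3 hL (l + 1)).toSubring ∧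
      SubringDominates (Bring p hxy hgen h3 hL l).toSubring (Bring p hxy hgen h3 hL (l + 1)).toSubring := by
  set i := l / p
  set j := l % p
  have hl : l = p * i + j := (Nat.div_add_mod l p).symm
  have hj : j < p := Nat.mod_lt _ hp.out.pos
  have h₁ : AlgebraicIndependent F ((stage p hxy hgen h3 hL i).bFam h3 j) :=
    (stage p hxy hgen h3 hL i).algebraicIndependent_bFam h3 j
  have h₂ : AlgebraicIndependent F ((stage p hxy hgen h3 hL i).bFam h3 (j + 1)) :=
    (stage p hxy hgen h3 hL i).algebraicIndependent_bFam h3 (j + 1)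
  have e₁ : Bring p hxy hgen h3 hL l = originLocalRing h₁ := by
    rw [show Bring p hxy hgen h3 hL l = Bring p hxy hgen h3 hL (p * i + j) by rw [← hl]]
    exact Bring_eq p hxy hgen h3 hL i j hj.le h₁
  have e₂ : Bring p hxy hgen h3 hL (l + 1) = originLocalRing h₂ := by
    rw [show Bring p hxy hgen h3 hL (l + 1) = Bring p hxy hgen h3 hL (p * i + (j + 1)) by rw [hl, add_assoc]]
    exact Bring_eq p hxy hgen h3 hL i (j + 1) hj h₂
  rw [e₁, e₂]
  exact isQuadraticTransform_bCoord_succ p _ hj h₁ h₂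

/-- **Every step of the `A`-tower is a quadratic transform with domination.**
[cite: Cutkosky2014, §3 (12) and Lemma 3.1] -/
theorem Aring_succ (m : ℕ) :
    IsQuadraticTransform (Aring p hxy hgen h3 hL m).toSubring (Aring p hxy hgen h3 hL (m + 1)).toSubring ∧
      SubringDominates (Aring p hxy hgen h3 hL m).toSubring (Aring p hxy hgen h3 hL (m + 1)).toSubring := by
  haveI := isAlgebraic_Kuv F p hgen
  set i := m / p
  set j := m % p
  have hl : m = p * i + j := (Nat.div_add_mod m p).symm
  have hj : j < p := Nat.mod_lt _ hp.out.pos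
  have h₁ : AlgebraicIndependent F ((stage p hxy hgen h3 hL i).aFam h3 j) :=
    (stage p hxy hgen h3 hL i).algebraicIndependent_aFam h3 j
  have h₂ : AlgebraicIndependent F ((stage p hxy hgen h3 hL i).aFam h3 (j + 1)) :=
    (stage p hxy hgen h3 hL i).algebraicIndependent_aFam h3 (j + 1)
  have e₁ : Aring p hxy hgen h3 hL m = originLocalRing h₁ := by
    rw [show Aring p hxy hgen h3 hL m = Aring p hxy hgen h3 hL (p * i + j) by rw [← hl]]
    exact Aring_eq p hxy hgen h3 hL i j hj.le h₁
  have e₂ : Aring p hxy hgen h3 hL (m + 1) = originLocalRing h₂ := by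
    rw [show Aring p hxy hgen h3 hL (m + 1) = Aring p hxy hgen h3 hL (p * i + (j + 1)) by rw [hl, add_assoc]]
    exact Aring_eq p hxy hgen h3 hL i (j + 1) hj h₂
  rw [e₁, e₂]
  exact isQuadraticTransform_bCoord_succ p _ hj h₁ h₂

/-- **`B_{pi}` dominates `A_{pi}`** (and contains it). [cite: Cutkosky2014, §3 (12)] -/
theorem dominates_Aring_Bring (i : ℕ) :
    Dominates F L (Aring p hxy hgen h3 hL (p * i)) (Bring p hxy hgen h3 hL (p * i)) := by
  rw [Aring_stage, Bring_stage]
  exact (stage p hxy hgen h3 hL i).hdom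

/-- **(C1) along the towers**: for `0 ≤ j < p`, `B_{pi+j}` dominates no quadratic transform of
`A_{pi}`. [cite: Cutkosky2014, Lemma 3.1 and §3 (p. 7)] -/
theorem not_dominates_quadraticTransform (i j : ℕ) (hj : j < p) (A' : Subring L)
    (hq : IsQuadraticTransform (Aring p hxy hgen h3 hL (p * i)).toSubring A') :
    ¬ SubringDominates A' (Bring p hxy hgen h3 hL (p * i + j)).toSubring := by
  set S := stage p hxy hgen h3 hL i
  have hB : AlgebraicIndependent F (S.bFam h3 j) := S.algebraicIndependent_bFam h3 j
  rw [Bring_eq p hxy hgen h3 hL i j hj.le hB]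
  rw [Aring_stage] at hq
  exact (hL F p h3 L S.a S.b S.ha S.hb S.hle S.hdom S.c S.f S.e S.τ S.shape (S.alpha h3)
    (S.alpha_ne_zero h3) (S.alpha_ne h3)).1 j hj hB A' hq

/-- **(C4) along the towers**: for `0 ≤ j < p`, `A_{pi} → B_{pi+j}` is not monomial (for any
presentation of the two rings as subalgebras `A ≤ B`). [cite: Cutkosky2014, Lemma 3.1 and §3 (p. 7)] -/
theorem not_isMonomialExtension (i j : ℕ) (hj : j < p) {A B : Subalgebra F L}
    (hA : A = Aring p hxy hgen h3 hL (p * i)) (hB : B = Bring p hxy hgen h3 hL (p * i + j))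
    (hle : A ≤ B) : ¬ @IsMonomialExtension A B _ _ (inclusionAlgebra hle) := by
  set S := stage p hxy hgen h3 hL i
  have hB' : AlgebraicIndependent F (S.bFam h3 j) := S.algebraicIndependent_bFam h3 j
  have eB : B = originLocalRing hB' := hB.trans (Bring_eq p hxy hgen h3 hL i j hj.le hB')
  have eA : A = originLocalRing S.ha := hA.trans (Aring_stage p hxy hgen h3 hL i)
  subst eB
  subst eA
  exact (hL F p h3 L S.a S.b S.ha S.hb S.hle S.hdom S.c S.f S.e S.τ S.shape (S.alpha h3)
    (S.alpha_ne_zero h3) (S.alpha_ne h3)).2.2 j hj hB' hle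

end Towers



end Cutkosky

end Literature.Barriers.ResolutionOfSingularities

end
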